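import Mathlib
import HarnessLib
import Summits.HubbardSuperconductivity.HubbardSuperconductivity.Theorems.KLProgrammeKLRegimeEngineTowerProfiles

/-!
# Route `KLProgramme` — crux K3 ENGINE (stmt-HubbardSuperconductivity-20437 `KLRegimeEngineV17F2`), stub (b): the blocked-tower bookkeeping,
# part 8 — re-measurement with a SPLIT (correlated) relative sector count (E1 lead r2d-p2 g5; U7-(c1), k3c2-p3 KL l.3094, memo §10)

On the lattice window the relative sector count of family-`J′` tuples refining a family-`J` tuple is sub-marginal (exponent `L − 3`) only OFF an
umklapp corner class of coarse tuples; ON the class it is marginal (exponent `L − 2`) but the class is small and its members have all coarse labels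
determined up to a pair, so the corresponding born sizes carry the LEVELS gain of the all-labels-known track (`4^{−J}` at six legs).  In the dimensionless
bookkeeping (units `2^{(3m−5)J}·2^{−e′J}` per track, so that every track obeys the same law `A λ^{m−1} Q^m`) the re-measurement hypothesis therefore has
TWO rows: the off-class row of parts 1–5 (ratio `g^{(m−2)·jump}`) on the track's own born sizes `b`, and an on-class row with one power of `g` LESS per
block (`g^{(m−3)·jump}`) but an absolute-level weight `h^{k′}` (`h = 4^{−d}`, `Σ_{k′} h^{k′} ≤ 1/(1−h)`) on the born sizes `b₂` of the all-known track:

* **`towerMeasured_le_profile_split`** — if `b k′ m, b₂ k′ m ≤ A λ^{m−1} Q^m` for `k′ ≤ k` (`3 ≤ m ≤ D`) and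
  `μ k m ≤ Σ_{k′≤k} c₁c₂^m g^{(m−2)(k+1−k′)} b k′ m + Σ_{k′≤k} c₃c₂^m g^{(m−3)(k+1−k′)} h^{k′} b₂ k′ m`, then
  `μ k m ≤ (c₁/((1−g)g²) + c₃/((1−h)g³)) · A · λ^{m−1} · (c₂ g Q)^m` — the SAME geometric profile as `towerMeasured_le_profile` with a larger amplitude, so
  T3♯/T3₄/T2-gen apply unchanged with `A′ ≥ (c₁/((1−g)g²) + c₃/((1−h)g³))·A`.  (At `m = 3` the on-class row has no `g` at all — `g^{0}` — and only the
  weight `h^{k′}`; that is the six-leg import `ι₃λ²` of the four-piece profile.)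
Pure real analysis; nothing about the model is asserted.
-/

noncomputable section

namespace Summit.HubbardSuperconductivity.HubbardSuperconductivity.Theorems.EngineV8

set_option linter.dupNamespace false -- summit = problem name (single-conjunct summit), D-0017

open Real Finset

/-- **Re-measurement with a split (correlated) count.**  Off-class row at ratio `g^{(m−2)·jump}` on the born sizes `b`, on-class row at ratio
`g^{(m−3)·jump}` with the absolute-level weight `h^{k′}` on the all-known-track born sizes `b₂`; both tracks under the law `Aλ^{m−1}Q^m` (each in its own
units).  Then `μ k m ≤ (c₁/((1−g)g²) + c₃/((1−h)g³))·A·λ^{m−1}·(c₂gQ)^m` for `3 ≤ m ≤ D`. -/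
theorem towerMeasured_le_profile_split {D : ℕ} {b b₂ μ : ℕ → ℕ → ℝ} {A lam Q g h c₁ c₂ c₃ : ℝ}
    (hA : 0 ≤ A) (hlam : 0 ≤ lam) (hQ : 0 ≤ Q) (hg0 : 0 < g) (hg1 : g < 1) (hh0 : 0 ≤ h) (hh1 : h < 1) (hc₁ : 0 ≤ c₁) (hc₂ : 0 ≤ c₂)
    (hc₃ : 0 ≤ c₃) (hb0 : ∀ k m, 0 ≤ b k m) (hb₂0 : ∀ k m, 0 ≤ b₂ k m) {k : ℕ}
    (hμ : ∀ m, 3 ≤ m → m ≤ D → μ k m ≤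
      ∑ k' ∈ range (k + 1), c₁ * c₂ ^ m * g ^ ((m - 2) * (k + 1 - k')) * b k' m +
        ∑ k' ∈ range (k + 1), c₃ * c₂ ^ m * g ^ ((m - 3) * (k + 1 - k')) * h ^ k' * b₂ k' m)
    (hborn : ∀ k' ≤ k, ∀ m, 3 ≤ m → m ≤ D → b k' m ≤ A * lam ^ (m - 1) * Q ^ m)
    (hborn₂ : ∀ k' ≤ k, ∀ m, 3 ≤ m → m ≤ D → b₂ k' m ≤ A * lam ^ (m - 1) * Q ^ m)
    {m : ℕ} (hm : 3 ≤ m) (hmD : m ≤ D) :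
    μ k m ≤ (c₁ / ((1 - g) * g ^ 2) + c₃ / ((1 - h) * g ^ 3)) * A * lam ^ (m - 1) * (c₂ * g * Q) ^ m := by
  have hg1' : 0 < 1 - g := sub_pos.2 hg1
  have hh1' : 0 < 1 - h := sub_pos.2 hh1
  -- the off-class row: `towerMeasured_le_profile` applied to the off-class majorant itself
  set μoff : ℕ → ℕ → ℝ := fun k m => ∑ k' ∈ range (k + 1), c₁ * c₂ ^ m * g ^ ((m - 2) * (k + 1 - k')) * b k' m with hμoff
  have hoff : μoff k m ≤ c₁ * A / ((1 - g) * g ^ 2) * lam ^ (m - 1) * (c₂ * g * Q) ^ m :=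
    towerMeasured_le_profile (D := D) (μ := μoff) hA hlam hQ hg0 hg1 hc₁ hc₂ hb0 (fun m _ _ => le_rfl) hborn hm hmD
  -- the on-class row: `g^{(m-3)(k+1-k')} ≤ g^{m-3}` and `Σ h^{k'} ≤ 1/(1-h)`
  have hon : ∑ k' ∈ range (k + 1), c₃ * c₂ ^ m * g ^ ((m - 3) * (k + 1 - k')) * h ^ k' * b₂ k' m ≤
      c₃ / ((1 - h) * g ^ 3) * A * lam ^ (m - 1) * (c₂ * g * Q) ^ m := by
    have hterm : ∀ k' ∈ range (k + 1), c₃ * c₂ ^ m * g ^ ((m - 3) * (k + 1 - k')) * h ^ k' * b₂ k' m ≤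
        (c₃ * c₂ ^ m * g ^ (m - 3) * (A * lam ^ (m - 1) * Q ^ m)) * h ^ k' := by
      intro k' hk'
      have hk'le : k' ≤ k := Nat.lt_succ_iff.1 (mem_range.1 hk')
      have hpow : g ^ ((m - 3) * (k + 1 - k')) ≤ g ^ (m - 3) :=
        pow_le_pow_of_le_one hg0.le hg1.le (Nat.le_mul_of_pos_right _ (by omega))
      have := hborn₂ k' hk'le m hm hmD
      have := hb₂0 k' m
      calc c₃ * c₂ ^ m * g ^ ((m - 3) * (k + 1 - k')) * h ^ k' * b₂ k' m
          ≤ c₃ * c₂ ^ m * g ^ (m - 3) * h ^ k' * (A * lam ^ (m - 1) * Q ^ m) := by gcongr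
        _ = _ := by ring
    refine (sum_le_sum hterm).trans ?_
    rw [← mul_sum]
    have hgeom : ∑ k' ∈ range (k + 1), h ^ k' ≤ 1 / (1 - h) := by
      have := geom_sum_Ico_le_of_lt_one hh0 hh1 (m := 0) (n := k + 1)
      rwa [pow_zero, ← range_eq_Ico] at this
    calc c₃ * c₂ ^ m * g ^ (m - 3) * (A * lam ^ (m - 1) * Q ^ m) * ∑ k' ∈ range (k + 1), h ^ k'
        ≤ c₃ * c₂ ^ m * g ^ (m - 3) * (A * lam ^ (m - 1) * Q ^ m) * (1 / (1 - h)) :=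
          mul_le_mul_of_nonneg_left hgeom (by positivity)
      _ = c₃ / ((1 - h) * g ^ 3) * A * lam ^ (m - 1) * (c₂ * g * Q) ^ m := by
          have hg3 : g ^ m = g ^ (m - 3) * g ^ 3 := by rw [← pow_add]; congr 1; omega
          rw [mul_pow, mul_pow, hg3]
          field_simp
  calc μ k m ≤ μoff k m + ∑ k' ∈ range (k + 1), c₃ * c₂ ^ m * g ^ ((m - 3) * (k + 1 - k')) * h ^ k' * b₂ k' m := hμ m hm hmD
    _ ≤ c₁ * A / ((1 - g) * g ^ 2) * lam ^ (m - 1) * (c₂ * g * Q) ^ m + c₃ / ((1 - h) * g ^ 3) * A * lam ^ (m - 1) * (c₂ * g * Q) ^ m :=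
        add_le_add hoff hon
    _ = _ := by ring

end Summit.HubbardSuperconductivity.HubbardSuperconductivity.Theorems.EngineV8

end
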